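import Summits.QuantumFields.YangMills.Theses.BalabanUVNodes
import Summits.QuantumFields.YangMills.Theorems.BalabanUVNodesK1WindowKOfRunRowsSurvivors
import Literature.MathematicalPhysics.QuantumFieldTheory.Balaban1983to89.Node00.Record13SepCoPHV

/-!
# DEF-1 g8 — PREVIEW CERTIFICATE for plan g85's kit `D85-REV28/`: route `BalabanUVNodes` re-targeted over the v1.8 VERSION SLOT
# `Node00.datumOfRecord₁₃SepCoPHV` (p620607 ✓ — director-ym №210 (A)(1) def-level object; plan WORD-3b §6 (δⱽ) spelling)

A crux WORKFILE (definer service BY NAME — NOT a route edit, NOT an item text of record; the revision is the planner's, director-pressed): the CANDIDATE item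
texts K1⁹ ∕ K2⁹ ∕ K3⁸ obtained from the rev-27 texts of `StabilityBRunRowsAtRecordR13SepCoPH` (K1⁸ 26907) ∕ `EndpointGivenRunRowsR13SepCoPH` (K2⁸ 26908) ∕
`SpineGivenEndpointR13SepCoPH` (K3⁷ 20544) by EXACTLY these substitutions — K1: the (B) conjunct `B16.EndStatementBPrinted (datumOfRecord₁₃SepCoPH F 2 θ h).C` ↦
`∃ v : Node00.Revision₁₃ F 2 θ h, B16.EndStatementBPrinted (Node00.datumOfRecord₁₃SepCoPHV F 2 θ h v).C` (B16's POINTWISE letter VERBATIM, the re-choice a visible ∃-slot;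
window ∕ rows ∕ guard ∕ admissibility BYTE-KEPT — they read flow ∕ θ only); K2, K3: one extra binder `(v : Node00.Revision₁₃ F 2 θ h)` after `h`, and (B) ∕ END ∕ the hybrid
prefix read AT `Node00.datumOfRecord₁₃SepCoPHV F 2 θ h v` (window ∕ rows byte-kept).  KERNEL FACTS for the SHAPE SHEET: (1) `closesV : K0⁷ → K1⁹ → K2⁹ → K3⁸ → BalabanLadder.UV`
elaborates (rev 27's `closes` proof with `v` threaded; UV's `∃ D` presented at the revised datum, `IsDatumOfRecord₀` by `rfl`); (2) K2⁹ HOLDS OUTRIGHT by the SAME one-liner as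
K2⁸ (an4 p616162: END reads `toB12` only; `(datumOfRecord₁₃SepCoPHV … v).C.toB12 = (datumOfRecord₁₃SepCoPH …).C.toB12` is `rfl`) — it can be born CLOSED again (support) — and so
does its (B)-free variant K2⁹′ with `closesVFree`; (3) DOORS: K1⁸ ⟹ K1⁹ (`v := .refl`; K1⁹ is the WEAKER display, as intended), K3⁸ ⟹ K3⁷ and K2⁹ ⟹ K2⁸ (instantiate
`v := .refl`; the ∀-v displays are the STRONGER ones; a K3⁸ supplier proves the version-free BODY `Node00.hybridNE7Under_datumOfRecord₁₃SepCoPHV_iff` under (B) at the revised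
datum).  WHY K2 CANNOT STAY BYTE-KEPT: K2⁸'s hypothesis list contains (B) AT THE v1.7 DATUM, which K1⁹ no longer supplies, and `closes` may use items + Literature only (the Theorems
closer is not importable into the route file) ⇒ K2 is re-displayed (K2⁹ or K2⁹′) and re-closed by the same term.  The (B)ᴬᴱ-display spelling of №210's letter would instead put a
B16-level a.e. predicate in K1 and the surgery lemma's conclusion shape in `closes` — not typed here (plan picks at press time; the (δⱽ) spelling needs NO new B16 predicate).

HONEST FRAMING: candidate texts + kernel glue + doors; NOTHING of Bałaban asserted or proved; no item of record touched (K1⁸ 26907 STAYS the key until the director-pressed revision);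
K0⁷ ∕ K1⁸ ∕ K3⁷ OPEN; counts UNMOVED (typed 28∕28 · discharged 5∕27 (A 5∕28)); [B12]∕[I] Thm 2 + (0.31) p.259 and (C) [I] §1 pp.263–264 UNPROVED in print; R4 = the CONDITIONAL
finite-𝕋⁴ rung `BalabanLadder.UV` only — NOT continuum ∕ ℝ⁴ ∕ OS ∕ mass gap; the YM mass gap (Clay) is NOT proved by any of this.
-/

noncomputable section

namespace Summit.QuantumFields.YangMills.Cruxes.EndpointGivenBR13SepCoPH.DEF1K19VersionSlotSketch

open Summit.QuantumFields.YangMills.Theses.BalabanUVNodes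
open Summit.QuantumFields.YangMills.Theorems.BalabanUVNodesK1WindowKOfRunRowsSurvivors (endpointExistence_datumOfRecord₁₃SepCoPH_of_runRows_survCont)

/-- CANDIDATE K1⁹ «StabilityBRunRowsAtRecordR13SepCoPHV»: K1⁸'s text (rev 27, stmt-QuantumFields-26907) VERBATIM except that the (B) conjunct is displayed over the version slot —
`∃ v : Node00.Revision₁₃ F 2 θ h, B16.EndStatementBPrinted (Node00.datumOfRecord₁₃SepCoPHV F 2 θ h v).C` ((2.50) POINTWISE for the record's level-(k ≥ 1) densities re-chosen within their
`dV`-a.e. classes; level 0, laws, integrals, flow, small-field data identical).  CANDIDATE TEXT, not an item. [cite: Balaban1989LargeFieldII, Thm 1 p.355; Balaban1988Convergent, Cor. 3 (2.50) p.264; Balaban1987RG1, Thm 3 p.264 (display, bookkeeping)] -/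
def StabilityBRunRowsAtRecordR13SepCoPHV : Prop :=
  ∀ F : Literature.MathematicalPhysics.QuantumFieldTheory.Balaban1983to89.T4Continuum.T4Family, (∃ θ : Literature.MathematicalPhysics.QuantumFieldTheory.Balaban1983to89.Node00.Stage13HParams F 2, θ.Provisos₁₃SepCoPH F 2 ∧ (θ.ZhUnity F 2 ∧ θ.SlotsNondegenerate₁₃ F 2) ∧ θ.Admissible F 2) → ∃ (θ : Literature.MathematicalPhysics.QuantumFieldTheory.Balaban1983to89.Node00.Stage13HParams F 2) (h : θ.Provisos₁₃SepCoPH F 2), (θ.ZhUnity F 2 ∧ θ.SlotsNondegenerate₁₃ F 2) ∧ θ.Admissible F 2 ∧ (∃ v : Literature.MathematicalPhysics.QuantumFieldTheory.Balaban1983to89.Node00.Revision₁₃ F 2 θ h, Literature.MathematicalPhysics.QuantumFieldTheory.Balaban1983to89.B16.EndStatementBPrinted (Literature.MathematicalPhysics.QuantumFieldTheory.Balaban1983to89.Node00.datumOfRecord₁₃SepCoPHV F 2 θ h v).C) ∧ (∃ γ₁ : ℝ, 0 < γ₁ ∧ ∀ γ : ℝ, 0 < γ → γ ≤ γ₁ →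 ∃ P : Literature.MathematicalPhysics.QuantumFieldTheory.Balaban1983to89.B12.RunParams, 1 ≤ P.K ∧ ((Literature.MathematicalPhysics.QuantumFieldTheory.Balaban1983to89.Node00.datumOfRecord₁₃SepCoPH F 2 θ h).C P).flow.InInterval γ P.K) ∧ ∃ (b : ℕ → ℝ) (r γ₀ M : ℝ), 0 < γ₀ ∧ (∀ (n : ℕ) (gs : ℕ → ℝ), Literature.MathematicalPhysics.QuantumFieldTheory.Balaban1983to89.FlowStep.RGEqH n (Literature.MathematicalPhysics.QuantumFieldTheory.Balaban1983to89.Node00.betaOfRecord₁₃ F 2 θ.toStage13Params) gs → Literature.MathematicalPhysics.QuantumFieldTheory.Balaban1983to89.Step.InInterval γ₀ n gs → ∀ k, k ≤ n → |Literature.MathematicalPhysics.QuantumFieldTheory.Balaban1983to89.Node00.betaOfRecord₁₃ F 2 θ.toStage13Params k (Literature.MathematicalPhysics.QuantumFieldTheory.Balaban1983to89.FlowStep.prefixOf gs k) - b k| ≤ r) ∧ (∀ (n : ℕ) (gs : ℕ → ℝ), Literature.MathematicalPhysics.QuantumFieldTheory.Balaban1983to89.FlowStep.RGEqH n (Literature.MathematicalPhysics.QuantumFieldTheory.Balaban1983to89.Node00.betaOfRecord₁₃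 F 2 θ.toStage13Params) gs → Literature.MathematicalPhysics.QuantumFieldTheory.Balaban1983to89.Step.InInterval γ₀ n gs → ∀ k, k ≤ n → -M ≤ ∑ j ∈ Finset.Ico k n, Literature.MathematicalPhysics.QuantumFieldTheory.Balaban1983to89.Node00.betaOfRecord₁₃ F 2 θ.toStage13Params j (Literature.MathematicalPhysics.QuantumFieldTheory.Balaban1983to89.FlowStep.prefixOf gs j)) ∧ ∀ k : ℕ, ContinuousOn (fun x : ℝ => Literature.MathematicalPhysics.QuantumFieldTheory.Balaban1983to89.Node00.betaOfRecord₁₃ F 2 θ.toStage13Params k (Literature.MathematicalPhysics.QuantumFieldTheory.Balaban1983to89.FlowStep.clampPrefix (Literature.MathematicalPhysics.QuantumFieldTheory.Balaban1983to89.Node00.betaOfRecord₁₃ F 2 θ.toStage13Params) γ₀ k x)) {x : ℝ | 0 < x ∧ x ≤ γ₀ ∧ ∀ j, j ≤ k → 1 / γ₀ ^ 2 ≤ Literature.MathematicalPhysics.QuantumFieldTheory.Balaban1983to89.FlowStep.Y (Literature.MathematicalPhysics.QuantumFieldTheory.Balaban1983to89.Node00.betaOfRecord₁₃ F 2 θ.toStage13Params)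 γ₀ j x}

/-- CANDIDATE K2⁹ «EndpointGivenRunRowsR13SepCoPHV»: K2⁸'s text (stmt-QuantumFields-26908) with one extra binder `(v : Node00.Revision₁₃ F 2 θ h)`, the (B) hypothesis and the END conclusion read at
`Node00.datumOfRecord₁₃SepCoPHV F 2 θ h v`; rows ∕ window byte-kept.  HOLDS OUTRIGHT (`endpointGivenRunRowsR13SepCoPHV_holds`).  CANDIDATE TEXT. [cite: Balaban1987RG1, Thm 2 p.259 (first sentence), Thm 3 p.264, (5.10) p.293 (display, bookkeeping)] -/
def EndpointGivenRunRowsR13SepCoPHV : Prop :=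
  ∀ (F : Literature.MathematicalPhysics.QuantumFieldTheory.Balaban1983to89.T4Continuum.T4Family) (θ : Literature.MathematicalPhysics.QuantumFieldTheory.Balaban1983to89.Node00.Stage13HParams F 2) (h : θ.Provisos₁₃SepCoPH F 2) (v : Literature.MathematicalPhysics.QuantumFieldTheory.Balaban1983to89.Node00.Revision₁₃ F 2 θ h), (θ.ZhUnity F 2 ∧ θ.SlotsNondegenerate₁₃ F 2) → θ.Admissible F 2 → Literature.MathematicalPhysics.QuantumFieldTheory.Balaban1983to89.B16.EndStatementBPrinted (Literature.MathematicalPhysics.QuantumFieldTheory.Balaban1983to89.Node00.datumOfRecord₁₃SepCoPHV F 2 θ h v).C → (∃ (b : ℕ → ℝ) (r γ₀ M : ℝ), 0 < γ₀ ∧ (∀ (n : ℕ) (gs : ℕ → ℝ), Literature.MathematicalPhysics.QuantumFieldTheory.Balaban1983to89.FlowStep.RGEqH n (Literature.MathematicalPhysics.QuantumFieldTheory.Balaban1983to89.Node00.betaOfRecord₁₃ F 2 θ.toStage13Params) gs → Literature.MathematicalPhysics.QuantumFieldTheory.Balaban1983to89.Step.InInterval γ₀ n gs → ∀ k, k ≤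 n → |Literature.MathematicalPhysics.QuantumFieldTheory.Balaban1983to89.Node00.betaOfRecord₁₃ F 2 θ.toStage13Params k (Literature.MathematicalPhysics.QuantumFieldTheory.Balaban1983to89.FlowStep.prefixOf gs k) - b k| ≤ r) ∧ (∀ (n : ℕ) (gs : ℕ → ℝ), Literature.MathematicalPhysics.QuantumFieldTheory.Balaban1983to89.FlowStep.RGEqH n (Literature.MathematicalPhysics.QuantumFieldTheory.Balaban1983to89.Node00.betaOfRecord₁₃ F 2 θ.toStage13Params) gs → Literature.MathematicalPhysics.QuantumFieldTheory.Balaban1983to89.Step.InInterval γ₀ n gs → ∀ k, k ≤ n → -M ≤ ∑ j ∈ Finset.Ico k n, Literature.MathematicalPhysics.QuantumFieldTheory.Balaban1983to89.Node00.betaOfRecord₁₃ F 2 θ.toStage13Params j (Literature.MathematicalPhysics.QuantumFieldTheory.Balaban1983to89.FlowStep.prefixOf gs j)) ∧ ∀ k : ℕ, ContinuousOn (fun x : ℝ => Literature.MathematicalPhysics.QuantumFieldTheory.Balaban1983to89.Node00.betaOfRecord₁₃ F 2 θ.toStage13Params k (Literature.MathematicalPhysics.QuantumFieldTheory.Balaban1983to89.FlowStep.clampPrefix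 (Literature.MathematicalPhysics.QuantumFieldTheory.Balaban1983to89.Node00.betaOfRecord₁₃ F 2 θ.toStage13Params) γ₀ k x)) {x : ℝ | 0 < x ∧ x ≤ γ₀ ∧ ∀ j, j ≤ k → 1 / γ₀ ^ 2 ≤ Literature.MathematicalPhysics.QuantumFieldTheory.Balaban1983to89.FlowStep.Y (Literature.MathematicalPhysics.QuantumFieldTheory.Balaban1983to89.Node00.betaOfRecord₁₃ F 2 θ.toStage13Params) γ₀ j x}) → (∃ γ₁ : ℝ, 0 < γ₁ ∧ ∀ γ : ℝ, 0 < γ → γ ≤ γ₁ → ∃ P : Literature.MathematicalPhysics.QuantumFieldTheory.Balaban1983to89.B12.RunParams, 1 ≤ P.K ∧ ((Literature.MathematicalPhysics.QuantumFieldTheory.Balaban1983to89.Node00.datumOfRecord₁₃SepCoPH F 2 θ h).C P).flow.InInterval γ P.K) → Literature.MathematicalPhysics.QuantumFieldTheory.Balaban1983to89.DagBinding.EndpointExistence (Literature.MathematicalPhysics.QuantumFieldTheory.Balaban1983to89.Node00.datumOfRecord₁₃SepCoPHV F 2 θ h v).C.toB12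

/-- CANDIDATE K2⁹′ (the (B)-FREE variant): the same with the (B) hypothesis dropped — END from the run rows alone is what the tree proves (an4 p616162 reads neither (B) nor unity nor the window).
CANDIDATE TEXT. [cite: Balaban1987RG1, Thm 2 p.259 (first sentence), Thm 3 p.264 (display, bookkeeping)] -/
def EndpointGivenRunRowsR13SepCoPHVFree : Prop :=
  ∀ (F : Literature.MathematicalPhysics.QuantumFieldTheory.Balaban1983to89.T4Continuum.T4Family) (θ : Literature.MathematicalPhysics.QuantumFieldTheory.Balaban1983to89.Node00.Stage13HParams F 2) (h : θ.Provisos₁₃SepCoPH F 2) (v : Literature.MathematicalPhysics.QuantumFieldTheory.Balaban1983to89.Node00.Revision₁₃ F 2 θ h), (θ.ZhUnity F 2 ∧ θ.SlotsNondegenerate₁₃ F 2) → θ.Admissible F 2 → (∃ (b : ℕ → ℝ) (r γ₀ M : ℝ), 0 < γ₀ ∧ (∀ (n : ℕ) (gs : ℕ → ℝ), Literature.MathematicalPhysics.QuantumFieldTheory.Balaban1983to89.FlowStep.RGEqH n (Literature.MathematicalPhysics.QuantumFieldTheory.Balaban1983to89.Node00.betaOfRecord₁₃ F 2 θ.toStage13Params)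 gs → Literature.MathematicalPhysics.QuantumFieldTheory.Balaban1983to89.Step.InInterval γ₀ n gs → ∀ k, k ≤ n → |Literature.MathematicalPhysics.QuantumFieldTheory.Balaban1983to89.Node00.betaOfRecord₁₃ F 2 θ.toStage13Params k (Literature.MathematicalPhysics.QuantumFieldTheory.Balaban1983to89.FlowStep.prefixOf gs k) - b k| ≤ r) ∧ (∀ (n : ℕ) (gs : ℕ → ℝ), Literature.MathematicalPhysics.QuantumFieldTheory.Balaban1983to89.FlowStep.RGEqH n (Literature.MathematicalPhysics.QuantumFieldTheory.Balaban1983to89.Node00.betaOfRecord₁₃ F 2 θ.toStage13Params) gs → Literature.MathematicalPhysics.QuantumFieldTheory.Balaban1983to89.Step.InInterval γ₀ n gs → ∀ k, k ≤ n → -M ≤ ∑ j ∈ Finset.Ico k n, Literature.MathematicalPhysics.QuantumFieldTheory.Balaban1983to89.Node00.betaOfRecord₁₃ F 2 θ.toStage13Params j (Literature.MathematicalPhysics.QuantumFieldTheory.Balaban1983to89.FlowStep.prefixOf gs j)) ∧ ∀ k : ℕ, ContinuousOn (fun x : ℝ => Literature.MathematicalPhysics.QuantumFieldTheory.Balaban1983to89.Node00.betaOfRecord₁₃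 F 2 θ.toStage13Params k (Literature.MathematicalPhysics.QuantumFieldTheory.Balaban1983to89.FlowStep.clampPrefix (Literature.MathematicalPhysics.QuantumFieldTheory.Balaban1983to89.Node00.betaOfRecord₁₃ F 2 θ.toStage13Params) γ₀ k x)) {x : ℝ | 0 < x ∧ x ≤ γ₀ ∧ ∀ j, j ≤ k → 1 / γ₀ ^ 2 ≤ Literature.MathematicalPhysics.QuantumFieldTheory.Balaban1983to89.FlowStep.Y (Literature.MathematicalPhysics.QuantumFieldTheory.Balaban1983to89.Node00.betaOfRecord₁₃ F 2 θ.toStage13Params) γ₀ j x}) → (∃ γ₁ : ℝ, 0 < γ₁ ∧ ∀ γ : ℝ, 0 < γ → γ ≤ γ₁ → ∃ P : Literature.MathematicalPhysics.QuantumFieldTheory.Balaban1983to89.B12.RunParams, 1 ≤ P.K ∧ ((Literature.MathematicalPhysics.QuantumFieldTheory.Balaban1983to89.Node00.datumOfRecord₁₃SepCoPH F 2 θ h).C P).flow.InInterval γ P.K) → Literature.MathematicalPhysics.QuantumFieldTheory.Balaban1983to89.DagBinding.EndpointExistence (Literature.MathematicalPhysics.QuantumFieldTheory.Balaban1983to89.Node00.datumOfRecord₁₃SepCoPHV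 F 2 θ h v).C.toB12

/-- CANDIDATE K3⁸ «SpineGivenEndpointR13SepCoPHV»: K3⁷'s text (stmt-QuantumFields-20544) with one extra binder `(v : Node00.Revision₁₃ F 2 θ h)` and (B), END, the hybrid-NE7 prefix read at
`Node00.datumOfRecord₁₃SepCoPHV F 2 θ h v` (its BODY is version-free: `Node00.hybridNE7Under_datumOfRecord₁₃SepCoPHV_iff`; its ANTECEDENT is (B) at the revised datum — why K3 is keyed AT the slot).
CANDIDATE TEXT. [cite: Balaban1985UVStability3d, (3) p.413; Balaban1989LargeFieldII, (0.1) p.356; King1986, (3.10)–(3.13) (display, bookkeeping)] -/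
def SpineGivenEndpointR13SepCoPHV : Prop :=
  ∀ (F : Literature.MathematicalPhysics.QuantumFieldTheory.Balaban1983to89.T4Continuum.T4Family) (θ : Literature.MathematicalPhysics.QuantumFieldTheory.Balaban1983to89.Node00.Stage13HParams F 2) (h : θ.Provisos₁₃SepCoPH F 2) (v : Literature.MathematicalPhysics.QuantumFieldTheory.Balaban1983to89.Node00.Revision₁₃ F 2 θ h), (θ.ZhUnity F 2 ∧ θ.SlotsNondegenerate₁₃ F 2) → θ.Admissible F 2 → Literature.MathematicalPhysics.QuantumFieldTheory.Balaban1983to89.B16.EndStatementBPrinted (Literature.MathematicalPhysics.QuantumFieldTheory.Balaban1983to89.Node00.datumOfRecord₁₃SepCoPHV F 2 θ h v).C → Literature.MathematicalPhysics.QuantumFieldTheory.Balaban1983to89.DagBinding.EndpointExistence (Literature.MathematicalPhysics.QuantumFieldTheory.Balaban1983to89.Node00.datumOfRecord₁₃SepCoPHV F 2 θ h v).C.toB12 → Literature.MathematicalPhysics.QuantumFieldTheory.Balaban1983to89.T4ApexHybrid.HybridNE7Under (Literature.MathematicalPhysics.QuantumFieldTheory.Balaban1983to89.Node00.datumOfRecord₁₃SepCoPHV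 F 2 θ h v) (Literature.MathematicalPhysics.QuantumFieldTheory.Balaban1983to89.DagBinding.EndpointExistence (Literature.MathematicalPhysics.QuantumFieldTheory.Balaban1983to89.Node00.datumOfRecord₁₃SepCoPHV F 2 θ h v).C.toB12)

/-- **THE RE-TARGETED DECIDING THEOREM (preview)**: K0⁷ → K1⁹ → K2⁹ → K3⁸ ⟹ the rung leaf `BalabanLadder.UV` — rev 27's `closes` proof with the version `v` threaded; UV's `∃ D` presented at the revised
datum `Node00.datumOfRecord₁₃SepCoPHV F 2 θ h v`, its Stage-0 clause by `rfl`.  Glue over CANDIDATE texts; closes nothing. [cite: Balaban1989LargeFieldII, Thm 1 + (0.1) pp.355–356; Balaban1987RG1, Thm 2 p.259 (glue, bookkeeping)] -/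
theorem closesV (h0 : Record13SepCoPHInhabited) (h1 : StabilityBRunRowsAtRecordR13SepCoPHV) (h2 : EndpointGivenRunRowsR13SepCoPHV)
    (h3 : SpineGivenEndpointR13SepCoPHV) : Summit.QuantumFields.YangMills.Theses.BalabanLadder.UV := by
  intro F
  obtain ⟨θ, h, hU, hθ, ⟨v, hb⟩, hwin, hrows⟩ := h1 F (h0 F)
  have hend : Literature.MathematicalPhysics.QuantumFieldTheory.Balaban1983to89.DagBinding.EndpointExistence (Literature.MathematicalPhysics.QuantumFieldTheory.Balaban1983to89.Node00.datumOfRecord₁₃SepCoPHV F 2 θ h v).C.toB12 :=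
    h2 F θ h v hU hθ hb hrows hwin
  exact ⟨Literature.MathematicalPhysics.QuantumFieldTheory.Balaban1983to89.Node00.datumOfRecord₁₃SepCoPHV F 2 θ h v,
    Literature.MathematicalPhysics.QuantumFieldTheory.Balaban1983to89.Node00.isDatumOfRecord₀_datumOfRecord₁₃SepCoPHV F 2 θ h v, hb, hend, h3 F θ h v hU hθ hb hend⟩

/-- … and with the (B)-free K2⁹′ in place of K2⁹. [cite: Balaban1989LargeFieldII, Thm 1 + (0.1) pp.355–356; Balaban1987RG1, Thm 2 p.259 (glue, bookkeeping)] -/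
theorem closesVFree (h0 : Record13SepCoPHInhabited) (h1 : StabilityBRunRowsAtRecordR13SepCoPHV) (h2 : EndpointGivenRunRowsR13SepCoPHVFree)
    (h3 : SpineGivenEndpointR13SepCoPHV) : Summit.QuantumFields.YangMills.Theses.BalabanLadder.UV := by
  intro F
  obtain ⟨θ, h, hU, hθ, ⟨v, hb⟩, hwin, hrows⟩ := h1 F (h0 F)
  have hend : Literature.MathematicalPhysics.QuantumFieldTheory.Balaban1983to89.DagBinding.EndpointExistence (Literature.MathematicalPhysics.QuantumFieldTheory.Balaban1983to89.Node00.datumOfRecord₁₃SepCoPHV F 2 θ h v).C.toB12 :=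
    h2 F θ h v hU hθ hrows hwin
  exact ⟨Literature.MathematicalPhysics.QuantumFieldTheory.Balaban1983to89.Node00.datumOfRecord₁₃SepCoPHV F 2 θ h v,
    Literature.MathematicalPhysics.QuantumFieldTheory.Balaban1983to89.Node00.isDatumOfRecord₀_datumOfRecord₁₃SepCoPHV F 2 θ h v, hb, hend, h3 F θ h v hU hθ hb hend⟩

/-- **K2⁹ HOLDS OUTRIGHT** — the same one-liner as K2⁸'s closer (an4 p616162 over dag-n24-w1's `endpointExistence_datumOfRecord₁₃SepCoPH_of_runRows_survCont`): END reads `toB12` only and the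
revised datum's `toB12` IS the record's (`Node00.endpointExistence_datumOfRecord₁₃SepCoPHV_iff`, `Iff.rfl`).  So the re-displayed support item can be BORN CLOSED again. [cite: Balaban1987RG1, Thm 2 p.259 (first sentence), Thm 3 p.264 and (5.10) p.293] -/
theorem endpointGivenRunRowsR13SepCoPHV_holds : EndpointGivenRunRowsR13SepCoPHV := by
  intro F θ h v _ _ _ hrows _
  obtain ⟨b, r, γ₀, M, hγ₀, hrem, hps, hsc⟩ := hrows
  exact (Literature.MathematicalPhysics.QuantumFieldTheory.Balaban1983to89.Node00.endpointExistence_datumOfRecord₁₃SepCoPHV_iff F 2 θ h v).mpr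
    (endpointExistence_datumOfRecord₁₃SepCoPH_of_runRows_survCont θ h hγ₀ hrem hps hsc)

/-- … and so does the (B)-free variant K2⁹′. [cite: Balaban1987RG1, Thm 2 p.259 (first sentence), Thm 3 p.264 and (5.10) p.293] -/
theorem endpointGivenRunRowsR13SepCoPHVFree_holds : EndpointGivenRunRowsR13SepCoPHVFree := by
  intro F θ h v _ _ hrows _
  obtain ⟨b, r, γ₀, M, hγ₀, hrem, hps, hsc⟩ := hrows
  exact (Literature.MathematicalPhysics.QuantumFieldTheory.Balaban1983to89.Node00.endpointExistence_datumOfRecord₁₃SepCoPHV_iff F 2 θ h v).mpr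
    (endpointExistence_datumOfRecord₁₃SepCoPH_of_runRows_survCont θ h hγ₀ hrem hps hsc)

/-- DOOR K1⁸ ⟹ K1⁹ (`v := Revision₁₃.refl`; `Node00.datumOfRecord₁₃SepCoPHV_refl` is `rfl`): the candidate is the WEAKER display — every proof of K1⁸ would close it verbatim. [cite: Balaban1989LargeFieldII, Thm 1 p.355 (bookkeeping)] -/
theorem stabilityBRunRowsV_of_k1R8 (h1 : StabilityBRunRowsAtRecordR13SepCoPH) : StabilityBRunRowsAtRecordR13SepCoPHV := by
  intro F hF
  obtain ⟨θ, h, hU, hθ, hb, hwin, hrows⟩ := h1 F hF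
  exact ⟨θ, h, hU, hθ, ⟨Literature.MathematicalPhysics.QuantumFieldTheory.Balaban1983to89.Node00.Revision₁₃.refl F 2 θ h, hb⟩, hwin, hrows⟩

/-- DOOR K3⁸ ⟹ K3⁷ (instantiate `v := .refl`): the ∀-v display is the STRONGER one. [cite: Balaban1989LargeFieldII, (0.1) p.356 (bookkeeping)] -/
theorem spineGivenEndpointR13SepCoPH_of_spineV (h3 : SpineGivenEndpointR13SepCoPHV) : SpineGivenEndpointR13SepCoPH :=
  fun F θ h hU hθ hb hend => h3 F θ h (Literature.MathematicalPhysics.QuantumFieldTheory.Balaban1983to89.Node00.Revision₁₃.refl F 2 θ h) hU hθ hb hend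

/-- DOOR K2⁹ ⟹ K2⁸ (instantiate `v := .refl`). [cite: Balaban1987RG1, Thm 2 p.259 (bookkeeping)] -/
theorem endpointGivenRunRowsR13SepCoPH_of_k2V (h2 : EndpointGivenRunRowsR13SepCoPHV) : EndpointGivenRunRowsR13SepCoPH :=
  fun F θ h hU hθ hb hrows hwin => h2 F θ h (Literature.MathematicalPhysics.QuantumFieldTheory.Balaban1983to89.Node00.Revision₁₃.refl F 2 θ h) hU hθ hb hrows hwin

end Summit.QuantumFields.YangMills.Cruxes.EndpointGivenBR13SepCoPH.DEF1K19VersionSlotSketch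

end
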